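import Mathlib.Combinatorics.SimpleGraph.Clique
import Mathlib.Combinatorics.SimpleGraph.Finite
import Mathlib.Combinatorics.SimpleGraph.VertexCover
import Mathlib.Algebra.Order.BigOperators.Group.Finset
import Mathlib.Data.Finset.Card
import Mathlib.Data.Fintype.Basic
import Mathlib.Tactic.Ring
import Mathlib.Tactic.Linarith
import HarnessLib

/-!
# The Buss kernel for `k`-Vertex-Cover, in clique form

For a graph `G` on `Fin n` and a parameter `k ≤ n`, "`G` has a clique on `n - k` vertices" is
the statement that the *complement* of `G` has a vertex cover of size `k` (the deleted
vertices). S. Buss' kernelization (Buss–Goldsmith 1993; textbook material of parameterized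
complexity, e.g. Downey–Fellows, Flum–Grohe) reduces this to a question about a graph with
`O(k²)` vertices and a budget `k - h`:

* a vertex with more than `k` non-neighbours (`high`) must be deleted; if there are `h > k` of
  them the answer is no;
* among the remaining (*low*) vertices only those with a low non-neighbour matter (`ker`, the
  non-isolated vertices of the kernel); if the answer is yes there are at most `2k²` of them;
* relabelling the kernel vertices by their rank (`rank`, order-preserving and injective on
  `ker`) gives the kernel graph `kerGraph G k R` on `Fin R` (`R ≥ 2k²`; adjacency `kerAdj`),
  and the answer is yes iff `h ≤ k`, `|ker| ≤ 2k²` and the kernel graph has a vertex cover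
  (Mathlib's `SimpleGraph.IsVertexCover`) with at most `k - h` vertices
  (`not_cliqueFree_iff_kernel`; the soundness half gives Buss' sharper `|ker| ≤ k + k²`).

This is the combinatorial half of the `AC⁰` kernelization circuits for `(n-k)`-Clique behind
hardness magnification (Oliveira–Santhanam 2018; Chen–Hirahara–Oliveira–Pich–Rajgopal–Santhanam
2020, proof of Prop. 50 (E1^𝒪), p. 27: "the circuit in [OS18] simulates a well-known
kernelization algorithm for `k`-Vertex-Cover. This algorithm produces a graph `H` containing
`O(k²)` vertices and a new parameter `k_H ≤ k`. This graph can be described by a string of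
length `O(k⁴)`" [arXiv191108297]): the quantities `[v ∈ high]`, `[i ≤ |high|]`,
`[v ∈ ker]`, `[i ≤ rank v]`, `kerAdj` are exactly what those circuits compute, and the three
conditions are what the single oracle gate decides. The counting identities at the end
(`card_high_*`, `rank_eq_card_subtype`, …) phrase them as cardinalities of sub-families of
literals, the form in which threshold circuits see them.

Mathlib has cliques (`SimpleGraph.CliqueFree`, `IsNClique`) and vertex covers
(`SimpleGraph.IsVertexCover`, `vertexCoverNum`, file `Combinatorics/SimpleGraph/VertexCover`),
which we use for the kernel graph; it has no kernelization. The circuit-level quantities keep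
thin local names (`nonNbrs`, `high`, `ker`, `rank`): `nonNbrs G v` is the neighbourhood of `v`
in the complement graph (`nonNbrs_eq_neighborFinset_compl`) and `v ∈ high G k` says
`k < degree of v in Gᶜ` (`mem_high_iff_degree_compl`).

## References

* J. F. Buss, J. Goldsmith, *Nondeterminism within P*, SIAM J. Comput. 22 (1993) (Buss' kernel).
* R. G. Downey, M. R. Fellows, *Fundamentals of Parameterized Complexity*, Springer (2013)
  (textbook account of Buss' kernel).
* I. C. Oliveira, R. Santhanam, *Hardness magnification for natural problems*, FOCS 2018.
* [arXiv191108297] L. Chen, S. Hirahara, I. C. Oliveira, J. Pich, N. Rajgopal, R. Santhanam,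
  *Beyond natural proofs: hardness magnification and locality*, ITCS 2020 / J. ACM 2022,
  Prop. 50 and its proof (p. 27 of the arXiv version); Appendix A, Prop. 63 (p. 37) for the
  `[1, (log n)^{4C}, 1]–AC⁰_d[m^{1+ε_d}]` form of the Oliveira–Santhanam bound.
-/

namespace Literature.Combinatorics.SimpleGraph

open Finset

variable {n : ℕ} (G : _root_.SimpleGraph (Fin n)) [DecidableRel G.Adj] (k : ℕ)

/-! ### The kernel data -/

/-- The non-neighbours of `v` other than `v` itself (the neighbours of `v` in the complement
graph). [folklore] -/
def nonNbrs (v : Fin n) : Finset (Fin n) := univ.filter fun u => u ≠ v ∧ ¬ G.Adj u v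

/-- The *high* vertices: more than `k` non-neighbours. Such a vertex lies outside every clique on
`n - k` vertices (Buss' rule). [folklore] -/
def high : Finset (Fin n) := univ.filter fun v => k + 1 ≤ (nonNbrs G v).card

/-- The *kernel* vertices: low vertices with a low non-neighbour (the non-isolated vertices of
the complement graph restricted to the low vertices). [folklore] -/
def ker : Finset (Fin n) :=
  univ.filter fun v => v ∉ high G k ∧ ∃ u, u ≠ v ∧ u ∉ high G k ∧ ¬ G.Adj u v

/-- The rank of `v`: the number of kernel vertices below `v` (an order-preserving relabelling
of `ker` by an initial segment of `ℕ`). [folklore] -/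
def rank (v : Fin n) : ℕ := ((ker G k).filter (· < v)).card

/-- The kernel adjacency on `Fin R`: `i ~ j` iff some two distinct non-adjacent kernel vertices
have ranks `i` and `j` (slots `≥ |ker|` are isolated). [folklore] -/
def kerAdj (R : ℕ) (i j : Fin R) : Prop :=
  ∃ u v, u ∈ ker G k ∧ v ∈ ker G k ∧ rank G k u = i ∧ rank G k v = j ∧ u ≠ v ∧ ¬ G.Adj u v

variable {G k}

/-! ### Elementary properties -/

/-- Membership in `nonNbrs`. [folklore] -/
theorem mem_nonNbrs {u v : Fin n} : u ∈ nonNbrs G v ↔ u ≠ v ∧ ¬ G.Adj u v := by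
  simp [nonNbrs]

/-- `nonNbrs G v` is the neighbourhood of `v` in the complement graph `Gᶜ`. [folklore] -/
theorem nonNbrs_eq_neighborFinset_compl (v : Fin n) : nonNbrs G v = Gᶜ.neighborFinset v := by
  ext u
  rw [mem_nonNbrs, SimpleGraph.mem_neighborFinset, SimpleGraph.compl_adj]
  exact ⟨fun ⟨h1, h2⟩ => ⟨h1.symm, fun h => h2 h.symm⟩,
    fun ⟨h1, h2⟩ => ⟨h1.symm, fun h => h2 h.symm⟩⟩

/-- Membership in `high`. [folklore] -/
theorem mem_high {v : Fin n} : v ∈ high G k ↔ k + 1 ≤ (nonNbrs G v).card := by simp [high]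

/-- `v` is high iff its degree in the complement graph exceeds `k`. [folklore] -/
theorem mem_high_iff_degree_compl {v : Fin n} : v ∈ high G k ↔ k < Gᶜ.degree v := by
  rw [mem_high, ← SimpleGraph.card_neighborFinset_eq_degree, ← nonNbrs_eq_neighborFinset_compl]
  exact Iff.rfl

/-- Membership in `ker`. [folklore] -/
theorem mem_ker {v : Fin n} :
    v ∈ ker G k ↔ v ∉ high G k ∧ ∃ u, u ≠ v ∧ u ∉ high G k ∧ ¬ G.Adj u v := by
  simp only [ker, mem_filter, mem_univ, true_and]

/-- Two distinct non-adjacent low vertices are both kernel vertices. [folklore] -/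
theorem mem_ker_of_low {u v : Fin n} (hu : u ∉ high G k) (hv : v ∉ high G k) (huv : u ≠ v)
    (hadj : ¬ G.Adj u v) : u ∈ ker G k ∧ v ∈ ker G k :=
  ⟨mem_ker.2 ⟨hu, v, huv.symm, hv, fun h => hadj h.symm⟩, mem_ker.2 ⟨hv, u, huv, hu, hadj⟩⟩

/-- `rank` is strictly monotone on `ker`. [folklore] -/
theorem rank_lt_rank {u v : Fin n} (hu : u ∈ ker G k) (huv : u < v) : rank G k u < rank G k v := by
  refine card_lt_card ⟨fun w hw => ?_, fun h => ?_⟩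
  · rw [mem_filter] at hw ⊢
    exact ⟨hw.1, hw.2.trans huv⟩
  · have := h (mem_filter.2 ⟨hu, huv⟩)
    exact lt_irrefl _ (mem_filter.1 this).2

/-- `rank` is injective on `ker`. [folklore] -/
theorem rank_injOn : Set.InjOn (rank G k) ↑(ker G k) := by
  intro u hu v hv h
  by_contra hne
  rcases lt_or_gt_of_ne hne with hlt | hlt
  · exact absurd h (rank_lt_rank hu hlt).ne
  · exact absurd h (rank_lt_rank hv hlt).ne'

/-- Ranks of kernel vertices are `< |ker|`. [folklore] -/
theorem rank_lt_card {v : Fin n} (hv : v ∈ ker G k) : rank G k v < (ker G k).card := by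
  refine card_lt_card ⟨filter_subset _ _, fun h => ?_⟩
  exact lt_irrefl _ (mem_filter.1 (h hv)).2

/-- `kerAdj` is symmetric. [folklore] -/
theorem kerAdj_symm {R : ℕ} {i j : Fin R} (h : kerAdj G k R i j) : kerAdj G k R j i := by
  obtain ⟨u, v, hu, hv, hui, hvj, huv, hadj⟩ := h
  exact ⟨v, u, hv, hu, hvj, hui, huv.symm, fun h => hadj h.symm⟩

/-- `kerAdj` is irreflexive (ranks are injective on `ker`). [folklore] -/
theorem kerAdj_irrefl {R : ℕ} (i : Fin R) : ¬ kerAdj G k R i i := by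
  rintro ⟨u, v, hu, hv, hui, hvi, huv, -⟩
  exact huv (rank_injOn hu hv (hui.trans hvi.symm))

variable (G k) in
/-- **The kernel graph** on `Fin R`: the complement of `G` restricted to the kernel vertices,
relabelled by rank (Buss' graph `H` with `O(k²)` vertices; Chen et al. 2020, proof of Prop. 50).
[folklore] -/
def kerGraph (R : ℕ) : _root_.SimpleGraph (Fin R) where
  Adj := kerAdj G k R
  symm := ⟨fun _ _ h => kerAdj_symm h⟩
  loopless := ⟨fun i h => kerAdj_irrefl i h⟩

/-- Adjacency in the kernel graph is `kerAdj` (definitional). [folklore] -/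
@[simp] theorem kerGraph_adj {R : ℕ} (i j : Fin R) : (kerGraph G k R).Adj i j ↔ kerAdj G k R i j :=
  Iff.rfl

/-! ### The kernel theorem -/

/-- **Buss' kernel, soundness half.** If `G` has a clique on `n - k` vertices (`k ≤ n`) then at
most `k` vertices are high, at most `k + k²` vertices are kernel vertices, and the kernel graph
(on any `Fin R`) has a vertex cover with at most `k - |high|` vertices. [folklore] -/
theorem kernel_of_not_cliqueFree {R : ℕ} (hk : k ≤ n) (h : ¬ G.CliqueFree (n - k)) :
    (high G k).card ≤ k ∧ (ker G k).card ≤ k + k * k ∧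
      ∃ T : Finset (Fin R), T.card ≤ k - (high G k).card ∧ (kerGraph G k R).IsVertexCover ↑T := by
  classical
  obtain ⟨S, hS⟩ := not_forall.1 h
  rw [not_not, SimpleGraph.isNClique_iff] at hS
  obtain ⟨hSclique, hScard⟩ := hS
  set D := univ \ S with hD
  have hDcard : D.card = k := by
    rw [hD, card_sdiff_of_subset (subset_univ S), card_univ, Fintype.card_fin, hScard]; omega
  -- every non-edge meets `D`
  have hcover : ∀ u v, u ≠ v → ¬ G.Adj u v → u ∈ D ∨ v ∈ D := by
    intro u v huv hadj
    by_contra hnot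
    rw [not_or] at hnot
    have huS : u ∈ S := by simpa [hD] using hnot.1
    have hvS : v ∈ S := by simpa [hD] using hnot.2
    exact hadj (hSclique huS hvS huv)
  -- high vertices are deleted
  have hhighD : high G k ⊆ D := by
    intro v hv
    by_contra hvD
    have hsub : nonNbrs G v ⊆ D := fun u hu =>
      ((hcover u v (mem_nonNbrs.1 hu).1 (mem_nonNbrs.1 hu).2).resolve_right hvD)
    have := (mem_high.1 hv).trans (card_le_card hsub)
    omega
  have hh : (high G k).card ≤ k := (card_le_card hhighD).trans hDcard.le
  -- the low deleted vertices cover the kernel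
  set D' := D \ high G k with hD'
  have hD'card : D'.card = k - (high G k).card := by
    rw [hD', card_sdiff_of_subset hhighD, hDcard]
  have hcover' : ∀ u v, u ∉ high G k → v ∉ high G k → u ≠ v → ¬ G.Adj u v →
      u ∈ D' ∨ v ∈ D' := by
    intro u v hu hv huv hadj
    rcases hcover u v huv hadj with h | h
    · exact Or.inl (mem_sdiff.2 ⟨h, hu⟩)
    · exact Or.inr (mem_sdiff.2 ⟨h, hv⟩)
  -- `|ker| ≤ |D'| (1 + k) ≤ k + k²`
  have hkercard : (ker G k).card ≤ k + k * k := by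
    have hsub : ker G k ⊆ D' ∪ D'.biUnion (nonNbrs G) := by
      intro v hv
      obtain ⟨hvlow, u, huv, hulow, hadj⟩ := mem_ker.1 hv
      rcases hcover' u v hulow hvlow huv hadj with h | h
      · exact mem_union_right _
          (mem_biUnion.2 ⟨u, h, mem_nonNbrs.2 ⟨huv.symm, fun h' => hadj h'.symm⟩⟩)
      · exact mem_union_left _ h
    have hdeg : ∀ w ∈ D', (nonNbrs G w).card ≤ k := by
      intro w hw
      have : w ∉ high G k := (mem_sdiff.1 hw).2
      rw [mem_high] at this
      omega
    have hD'le : D'.card ≤ k := by rw [hD'card]; exact Nat.sub_le k _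
    calc (ker G k).card ≤ (D' ∪ D'.biUnion (nonNbrs G)).card := card_le_card hsub
      _ ≤ D'.card + (D'.biUnion (nonNbrs G)).card := card_union_le _ _
      _ ≤ D'.card + ∑ w ∈ D', (nonNbrs G w).card := Nat.add_le_add_left card_biUnion_le _
      _ ≤ D'.card + ∑ _w ∈ D', k := Nat.add_le_add_left (sum_le_sum hdeg) _
      _ = D'.card + D'.card * k := by rw [sum_const_nat fun _ _ => rfl]
      _ ≤ k + k * k := Nat.add_le_add hD'le (Nat.mul_le_mul_right _ hD'le)
  refine ⟨hh, hkercard, ?_⟩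
  -- the cover: the ranks of the kernel vertices in `D'`
  refine ⟨univ.filter fun i : Fin R => ∃ v ∈ D' ∩ ker G k, rank G k v = i, ?_, ?_⟩
  · set T := univ.filter fun i : Fin R => ∃ v ∈ D' ∩ ker G k, rank G k v = i
    have himg : T.image Fin.val ⊆ (D' ∩ ker G k).image (rank G k) := by
      intro m hm
      obtain ⟨i, hi, rfl⟩ := mem_image.1 hm
      obtain ⟨v, hv, hvi⟩ := (mem_filter.1 hi).2
      exact mem_image.2 ⟨v, hv, hvi⟩
    calc T.card = (T.image Fin.val).card := (card_image_of_injective _ Fin.val_injective).symm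
      _ ≤ ((D' ∩ ker G k).image (rank G k)).card := card_le_card himg
      _ ≤ (D' ∩ ker G k).card := card_image_le
      _ ≤ D'.card := card_le_card inter_subset_left
      _ = k - (high G k).card := hD'card
  · rintro i j ⟨u, v, hu, hv, hui, hvj, huv, hadj⟩
    have hulow := (mem_ker.1 hu).1
    have hvlow := (mem_ker.1 hv).1
    rcases hcover' u v hulow hvlow huv hadj with h | h
    · exact Or.inl (mem_coe.2 (mem_filter.2 ⟨mem_univ _, u, mem_inter.2 ⟨h, hu⟩, hui⟩))
    · exact Or.inr (mem_coe.2 (mem_filter.2 ⟨mem_univ _, v, mem_inter.2 ⟨h, hv⟩, hvj⟩))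

/-- **Buss' kernel, completeness half.** If at most `k ≤ n` vertices are high, there are at
most `R` kernel vertices, and the kernel graph on `Fin R` has a vertex cover with at most
`k - |high|` vertices, then `G` has a clique on `n - k` vertices: delete
the high vertices and the kernel vertices whose rank is in the cover (at most `k` vertices; pad
to exactly `k`); any non-edge among the rest would be a kernel edge missed by the cover.
[folklore] -/
theorem not_cliqueFree_of_kernel {R : ℕ} (hk : k ≤ n) (hh : (high G k).card ≤ k)
    (hkerR : (ker G k).card ≤ R) {T : Finset (Fin R)} (hTcard : T.card ≤ k - (high G k).card)
    (hT : (kerGraph G k R).IsVertexCover ↑T) : ¬ G.CliqueFree (n - k) := by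
  classical
  -- deleted vertices: the high ones and the kernel vertices whose rank lies in `T`
  set K := (ker G k).filter fun v => rank G k v ∈ T.image Fin.val with hK
  set D₀ := high G k ∪ K with hD₀
  have hKcard : K.card ≤ T.card := by
    calc K.card ≤ (T.image Fin.val).card :=
          card_le_card_of_injOn (rank G k) (fun v hv => (mem_filter.1 hv).2)
            (rank_injOn.mono (coe_subset.2 (filter_subset _ _)))
      _ ≤ T.card := card_image_le
  have hD₀card : D₀.card ≤ k :=
    calc D₀.card ≤ (high G k).card + K.card := card_union_le _ _
      _ ≤ (high G k).card + (k - (high G k).card) :=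
          Nat.add_le_add_left (hKcard.trans hTcard) _
      _ = k := Nat.add_sub_cancel' hh
  -- every non-edge meets `D₀`
  have hcover : ∀ u v, u ≠ v → ¬ G.Adj u v → u ∈ D₀ ∨ v ∈ D₀ := by
    intro u v huv hadj
    by_cases hu : u ∈ high G k
    · exact Or.inl (mem_union_left _ hu)
    by_cases hv : v ∈ high G k
    · exact Or.inr (mem_union_left _ hv)
    obtain ⟨huker, hvker⟩ := mem_ker_of_low hu hv huv hadj
    -- the kernel edge `(rank u, rank v)` is covered by `T`
    set i : Fin R := ⟨rank G k u, (rank_lt_card huker).trans_le hkerR⟩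
    set j : Fin R := ⟨rank G k v, (rank_lt_card hvker).trans_le hkerR⟩
    have hadj' : (kerGraph G k R).Adj i j := ⟨u, v, huker, hvker, rfl, rfl, huv, hadj⟩
    rcases hT hadj' with h | h
    · exact Or.inl (mem_union_right _ (mem_filter.2 ⟨huker, mem_image.2 ⟨i, mem_coe.1 h, rfl⟩⟩))
    · exact Or.inr (mem_union_right _ (mem_filter.2 ⟨hvker, mem_image.2 ⟨j, mem_coe.1 h, rfl⟩⟩))
  -- pad `D₀` to exactly `k` deleted vertices; the rest is a clique on `n - k` vertices
  obtain ⟨D, hD₀D, -, hDcard⟩ := exists_subsuperset_card_eq (subset_univ D₀) hD₀card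
    (by rw [card_univ, Fintype.card_fin]; exact hk)
  intro hfree
  refine hfree (univ \ D) ⟨?_, ?_⟩
  · intro u hu v hv huv
    by_contra hadj
    have hu' : u ∉ D := (mem_sdiff.1 (mem_coe.1 hu)).2
    have hv' : v ∉ D := (mem_sdiff.1 (mem_coe.1 hv)).2
    rcases hcover u v huv hadj with h | h
    · exact hu' (hD₀D h)
    · exact hv' (hD₀D h)
  · rw [card_sdiff_of_subset (subset_univ D), card_univ, Fintype.card_fin, hDcard]

/-- **Buss' kernel theorem for `(n-k)`-Clique.** For `k ≤ n` and `R ≥ 2k²`: `G` has a clique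
on `n - k` vertices iff at most `k` vertices are high, at most `2k²` vertices are kernel
vertices, and the kernel graph on `Fin R` has a vertex cover with at most `k - |high|`
vertices (Buss–Goldsmith 1993; the form used by Oliveira–Santhanam 2018 and by Chen et al.,
proof of Prop. 50: "If `𝒪` solves vertex cover, the resulting oracle circuit correctly solves
`(n-k)`-Clique"). [cite: arXiv191108297, proof of Prop. 50 p. 27] -/
theorem not_cliqueFree_iff_kernel {R : ℕ} (hk : k ≤ n) (hR : 2 * k ^ 2 ≤ R) :
    ¬ G.CliqueFree (n - k) ↔ (high G k).card ≤ k ∧ (ker G k).card ≤ 2 * k ^ 2 ∧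
      ∃ T : Finset (Fin R), T.card ≤ k - (high G k).card ∧ (kerGraph G k R).IsVertexCover ↑T := by
  refine ⟨fun h => ?_, fun ⟨hh, hker, T, hTcard, hT⟩ => ?_⟩
  · obtain ⟨hh, hker, hT⟩ := kernel_of_not_cliqueFree (R := R) hk h
    exact ⟨hh, hker.trans (by nlinarith), hT⟩
  · exact not_cliqueFree_of_kernel hk hh (hker.trans hR) hTcard hT

/-! ### Counting identities (the quantities as sizes of sub-families of literals) -/

/-- `|{a // p a} ∩ q| = |p ∧ q|`. [folklore] -/
theorem card_filter_subtype_eq {α : Type*} [Fintype α] (p q : α → Prop) [DecidablePred p]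
    [DecidablePred q] :
    (univ.filter fun a : {a // p a} => q a.1).card = (univ.filter fun a => p a ∧ q a).card := by
  rw [← Fintype.card_subtype, ← Fintype.card_subtype]
  exact Fintype.card_congr ((Equiv.subtypeSubtypeEquivSubtypeInter p q))

/-- The number of non-neighbours of `v`, as the number of true literals `¬ x_{uv}`, `u ≠ v`.
[folklore] -/
theorem card_nonNbrs_eq (v : Fin n) :
    (nonNbrs G v).card = (univ.filter fun u : {u // u ≠ v} => ¬ G.Adj u.1 v).card :=
  (card_filter_subtype_eq (fun u => u ≠ v) (fun u => ¬ G.Adj u v)).symm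

/-- The rank of `v`, as the number of kernel vertices among `u < v`. [folklore] -/
theorem rank_eq_card_subtype (v : Fin n) :
    rank G k v = (univ.filter fun u : {u // u < v} => u.1 ∈ ker G k).card := by
  rw [card_filter_subtype_eq (fun u => u < v) (fun u => u ∈ ker G k), rank]
  congr 1
  ext u
  simp [and_comm]

/-- `rank v = i` in terms of the threshold bits `[i ≤ rank v]`, `[i + 1 ≤ rank v]`. [folklore] -/
theorem rank_eq_iff (v : Fin n) (i : ℕ) :
    rank G k v = i ↔ i ≤ rank G k v ∧ ¬ (i + 1 ≤ rank G k v) := by omega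

end Literature.Combinatorics.SimpleGraph
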